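import Literature.MathematicalPhysics.QuantumFieldTheory.Balaban1983to89.B9RWSumsDefinitePinsPairMDir3Rows
import Literature.MathematicalPhysics.QuantumFieldTheory.Balaban1983to89.B9RWSumsDefinitePinsPairMDir4

/-!
# `Balaban1983to89.B9RWSumsDefinitePinsPairMDir4Rows` — rows 13 ∕ 18 ∕ 19 of the N06 census at def-Y's members with definite expansion data, both sides over the
# direction letters, ₄ EDITION of the consumer face `B9RWSumsDefinitePinsPairMDir3Rows.rows131819_definite_geo9Y_pairM_dir₃`: BOTH WALK READINGS' support
# clauses RELATIVE to `Rel x` (`WalkReading.OKRel` ∕ `WalkReading310.OKRel`, node00-def-Y RULING (A) on WORD-W1) — TWO binders re-typed, TWO calls re-pointed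

T. Bałaban, *Propagators for lattice gauge theories in a background field*, Commun. Math. Phys. **99** (1985) 389–434
[`Balaban1985BackgroundPropagators`, "B9"], Thm 3.7 p. 409, Cor. 3.8 p. 410, Thm 3.10 (3.105)–(3.108) pp. 414–416, Thm 3.7 ⇒ Thm 3.1 p. 410, Thm 3.10 ⇒ Thm 3.3
p. 416, (3.42)–(3.47) pp. 397–398, Cor. 3.6 p. 408; T. Bałaban, *Propagators and renormalization transformations for lattice gauge theories. II*, Commun. Math.
Phys. **96** (1984) 223–250 [`Balaban1984PropagatorsII`, "[4]"], (2.51)–(2.52) p. 232, Lemma 2.1 (2.59)–(2.61) pp. 233–234.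

statement-level skeleton of published theorems with citation tags; proofs where landed; nothing here is a claim about the
Yang–Mills mass gap

WHY THIS FILE (cell `pub-ymgap`, Track A node N06 [B9]; dag-n06-d g14 WORD-W1 l.42852, node00-def-Y g25 RULING (A) l.42897; seat `pub-ymgap-dag-n06-c` g16).
The ₃ consumer face — the one the stage-11 certificate of record calls (`…V6EPairOX ∕ OY`) — displays the G′-side walk reading in the STRICT form
`hrd : ∀ x, (rd x).OK (𝔬 x).blk`, which no faithful evaluation inhabits at the record (the ≤ d + 1 index bonds at one base site share the carrier block), so the
certificate keeps `rd ∕ hrd` displayed and VACUOUS-AS-TYPED in that corner; the G-side reading `rdA ∕ hrdA` (Theorem 3.10, still generic letters in the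
certificate) carries the same clause.  This ₄ face re-types BOTH binders as `hrd : ∀ x, (rd x).OKRel (𝔬 x).blk (Rel x)`, `hrdA : ∀ x, (rdA x).OKRel (𝔬A x).blk
(Rel x)` (the block equivalence `Rel x`, multiplicity `m`, saturation `hRd₂` and count `hmult` are ALREADY binders of the face) and re-points the two one-sided
calls to dag-n06-c's `B9RWSumsDefinitePinsPairMDir4.thm37_cor38_complete_geo9Y_pairM_dir₄ ∕ thm310_complete_geo9Y_pairM_dir₄`; every other character of the
statement and of the proof is the ₃ text VERBATIM (private arithmetic helpers copied).  At the record `rd := ⟨evSK, agreeWalkY⟩` inhabits `OKRel … (RelB x.toKIdx)` by dag-n06-d's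
`B9CoReadingCoordsS.off_bound_evSK`.  ★★★ `rows131819_definite_geo9Y_pairM_dir₄`.

HONEST SCOPE.  Bookkeeping composition; every operator-level input is a HYPOTHESIS schema; nothing of [B9] asserted; COUNT-NEUTRAL; N06 NOT discharged; K1⁹
NOT closed; one finite lattice programme — nothing continuum, nothing about OS positivity or the mass gap; the YM mass gap (Clay) is NOT proved by any of
this — R4 closes the conditional finite-𝕋⁴ rung `BalabanLadder.UV` only.
-/

namespace Literature.MathematicalPhysics.QuantumFieldTheory.Balaban1983to89.B9RWSumsDefinitePinsPairMDir4Rows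

open Finset B6RandomWalk B9Thm34Ext B9Thm37Whole B9Cor38Whole B9Thm310Whole B9RowSum261Faces B9RowSum261DefiniteFaces
open B9Ineq349Whole B9RWSums343to347Whole B9PinMembersKLevelV1 B9GeoLemma21KLevelV1 B9RWSums347DefiniteFaces
open B9Thm37GlueCor36 B9Thm37Glue B9RWSums346Schur B9RWSums343Holder B9RWSums343HolderGp B9RWSums346Lap B9RWSums344Input
open B9RWSums344InputGp B9RWSums346Two B9RWSums346TwoGp B11SectG B9RWSumsCompleteGeo9Y B9RWSumsDefinitePins
open B9CoRealizesRel B9RWSumsReadsRel B9RWSumsReadsNbr B9RWSumsAllBlocksNbr B9RWSumsCompleteGeo9YNbr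
open B9RWSums346SecondDiff B9RWSums346SecondDiffGp B9RWSumsAllBlocksPair B9RWSumsCompleteGeo9YPair
open B9RWSumsDefinitePinsNbr B9RWSumsDefinitePinsPair B9RWSums346MixedPair B9RWSums344InputFam B9RWSums344InputPair B9RWSumsAllBlocksPairM
open B9RWSumsCompleteGeo9YPairM B9RWSumsDefinitePinsPairM
open Literature.MathematicalPhysics.QuantumFieldTheory.Balaban1983to89.B9RWSumsCompleteGeo9Y (const37_nonneg_of_signs)
open B9Thm37WholeDir B9Thm37KLetterDir B9RWSums343HolderGpDir B9RWSumsAllBlocksPairMDir B9Cor38WholeDir B9RWSumsDefinitePinsPairMDir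
open B9Thm310WholeDir B9RWSums343HolderDir B9RWSumsAllBlocksPairMGDir
open B9RWSumsDefinitePinsPairMDirA B9RWSumsAllBlocksPairMDir3 B9RWSumsAllBlocksPairMGDir3 B9RWSumsDefinitePinsPairMDir3
open B9RWSumsDefinitePinsPairMDir4 B9Cor38WholeRel B9Cor38WholeRelFaces B9Thm310WholeRel

noncomputable section

section StageY

variable {d ℓ : ℕ} {hd : 1 ≤ d + 1} {hL : Odd (ℓ + 1) ∧ 1 < ℓ + 1} {b₀ b₁ : ℝ} {Mstar : ℕ}
variable [∀ x : MemberY d ℓ hd hL b₀ b₁ Mstar, Fintype (geo9Y x).Site]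
  [∀ x : MemberY d ℓ hd hL b₀ b₁ Mstar, DecidableEq (geo9Y x).Site]
variable {c35 : ℝ} {bg : MemberY d ℓ hd hL b₀ b₁ Mstar → B9.Backgrounds}

/-- `lowerB_{G′} ≤ B1Y` (twin of the sibling's private lemma). [folklore] -/
private theorem lowerB_le_B1Y_left₄ (p q : PinPrims) (dp dFp dq dFq : ℕ) (L₀ : ℝ) :
    p.lowerB dp dFp p.N' L₀ ≤ B1Y p q dp dFp dq dFq L₀ :=
  (le_max_left _ _).trans (le_max_right _ _)

/-- `lowerB_G ≤ B1Y` (twin of the sibling's private lemma). [folklore] -/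
private theorem lowerB_le_B1Y_right₄ (p q : PinPrims) (dp dFp dq dFq : ℕ) (L₀ : ℝ) :
    q.lowerB dq dFq q.NF L₀ ≤ B1Y p q dp dFp dq dFq L₀ :=
  (le_max_right _ _).trans (le_max_right _ _)

/-- `C ≤ pinLowerB …`. [folklore] -/
private theorem le_pinLowerB₁₄ (C cF lapC twoC L₀ : ℝ) : C ≤ pinLowerB C cF lapC twoC L₀ :=
  (le_max_left _ _).trans ((le_max_left _ _).trans ((le_max_left _ _).trans (le_max_left _ _)))

/-- `C·L₀ ≤ pinLowerB …`. [folklore] -/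
private theorem le_pinLowerB₂₄ (C cF lapC twoC L₀ : ℝ) : C * L₀ ≤ pinLowerB C cF lapC twoC L₀ :=
  (le_max_right _ _).trans ((le_max_left _ _).trans ((le_max_left _ _).trans (le_max_left _ _)))

/-- `C·c_F·L₀⁴ ≤ pinLowerB …`. [folklore] -/
private theorem le_pinLowerB₃₄ (C cF lapC twoC L₀ : ℝ) : C * cF * L₀ ^ (4 : ℝ) ≤ pinLowerB C cF lapC twoC L₀ :=
  (le_max_right _ _).trans ((le_max_left _ _).trans (le_max_left _ _))

/-- `√(C·lapC)·L₀ ≤ pinLowerB …`. [folklore] -/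
private theorem le_pinLowerB₄₄ (C cF lapC twoC L₀ : ℝ) : Real.sqrt (C * lapC) * L₀ ≤ pinLowerB C cF lapC twoC L₀ :=
  (le_max_right _ _).trans (le_max_left _ _)

/-! ## §3 ★★★ Rows 13 ∕ 18 ∕ 19 as ONE face at the definite `Pair` E-letters -/

set_option maxHeartbeats 400000 in
-- build stability: the v3.1 twin needed the same guard in the tree (ops-buildfix-2, p516056)
/-- ★★★ **(₄ EDITION — BOTH walk readings' support clauses RELATIVE to `Rel x`: `hrd : ∀ x, (rd x).OKRel (𝔬 x).blk (Rel x)`, `hrdA : ∀ x, (rdA x).OKRel (𝔬A x).blk (Rel x)`; the two one-sided faces are dag-n06-c's `thm37_cor38_complete_geo9Y_pairM_dir₄` ∕ `thm310_complete_geo9Y_pairM_dir₄`; everything else VERBATIM the ₃ text that follows.)** **(₃ EDITION — the second-order pair families of BOTH sides by the LEFT Neumann series: `h36H ∋ FactorsL2Second37Dir … p3.θ3 …` ↦ the three G′-side letter transposes, `h36HA ∋ FactorsL2Second310 … q3.θ3 …` ↦ `∀ a, IsTransposePair (Rt U a) (Rf U a)`; the E-letters are the v3 ones AT THE RECORDS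 `⟨p3.N3, 2·p3.B3, 0⟩ ∕ ⟨q3.N3, 2·q3.B3, 0⟩` (so that `secondConst … = 2N₃B₃`, the third-order slot zero — no new constant letters); `p3.θ3 ∕ q3.θ3` are NOT read; through §1 ∕ §2 of this file; everything else VERBATIM the v3 text that follows.)** **(v3, BOTH SIDES OVER THE DIRECTION LETTERS — R1′ (G′: `h36 ∋ DirSupSq37 ∧ Identities₂`, `HolderV37Dir`, `Factors…37Dir`, `LocalityDir`, E-letter `E37YPairMDir`) AND
R1′-A (G: `h36A ∋ DirSupSq310 ∧ Identities310₂`, new family `𝔩A : DirLetters310`); everything else VERBATIM `B9RWSumsDefinitePinsPairM.rows131819_definite_geo9Y_pairM`.)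
ROWS 13 ∕ 18 ∕ 19 OF THE N06 CENSUS AT def-Y's MEMBERS WITH DEFINITE EXPANSION DATA, NEIGHBOURHOOD-SITED CO-READINGS, AND THE
PRINTED SECOND-ORDER L² MEMBERS AS DIRECTION-PAIR FAMILIES** — the `Pair` form of `B9RWSumsDefinitePinsNbr.rows131819_definite_geo9Y_nbr`:
Theorem 3.7 ∧ Corollary 3.8 at `E37YPair m mN Cev NQ p q p3 q3`, Theorem 3.10 at `E310YPair …` and the summation leaf for the pair, from the sign
records `p q` (sibling's) and `p3 q3` (second-order legs and factors), the direction count bound `NQ`, ONE block equivalence `Rel x` with class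
multiplicity and saturation, the neighbourhood count, the evaluation constant, the direction letters `𝔡 𝔡A`, and the OPERATOR-LEVEL inputs of
both sides (the Laplacian legs replaced by `L2SecondLegs… ∧ FactorsL2Second… ∧ DirTranspose…`; `hl4 hl5 hlA4 hlA5` read the `familyOp`
packages of ∇∇G′, G′∇\*∇\*, ∇∇G, G∇\*∇\*, `hl3 hlA3` the mixed members ∇G′∇\*, ∇G∇\* on the PAIR FAMILY `Dd ∘ G ∘ Dsd` (v4), `hIR hIRA` the (3.44)∕(3.45)
members on the same family through `InputReadsFam` with sliced X-probes — def-Y's K-index order).  Inside: `thm37_cor38_complete_geo9Y_pairM` ∕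
`thm310_complete_geo9Y_pairM` at B₁ := `nbrScale … · B1PairM …`,
δ₁ := `delta1Y p q`, the three Hölder∕input families scaled by `nbrScale …`, and `rwSumsYieldIneqs_allPins`.  Nothing of print asserted; NOT a node
discharge.
[cite: Balaban1985BackgroundPropagators, Thm 3.7 p.409 + Cor. 3.8 p.410 + Thm 3.10 pp.415–416 + Thm 3.7 ⇒ Thm 3.1 p.410 + Thm 3.10 ⇒ Thm 3.3 p.416 + Cor. 3.6 p.408; Balaban1984PropagatorsII, (2.51)–(2.52) p.232 + Lemma 2.1 pp.233–234] -/
theorem rows131819_definite_geo9Y_pairM_dir₄ {X Y ι PX PY Q XA YA ιA AA PXA PYA QA : MemberY d ℓ hd hL b₀ b₁ Mstar → Type}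
    [∀ x, Fintype (X x)] [∀ x, DecidableEq (X x)] [∀ x, Fintype (Y x)] [∀ x, DecidableEq (Y x)] [∀ x, Fintype (ι x)]
    [∀ x, Fintype (PX x)] [∀ x, DecidableEq (PX x)] [∀ x, Fintype (PY x)] [∀ x, DecidableEq (PY x)]
    [∀ x, Fintype (XA x)] [∀ x, DecidableEq (XA x)] [∀ x, Fintype (YA x)] [∀ x, DecidableEq (YA x)] [∀ x, Fintype (ιA x)]
    [∀ x, Fintype (AA x)] [∀ x, Fintype (PXA x)] [∀ x, DecidableEq (PXA x)] [∀ x, Fintype (PYA x)] [∀ x, DecidableEq (PYA x)]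
    [∀ x, Fintype (Q x)] [∀ x, Fintype (QA x)]
    (p q : PinPrims) (hp : p.OK) (hq : q.OK) (p3 q3 : PairPrims) (hp3 : p3.OK) (hq3 : q3.OK) (pM qM : MixedPrims) (hpM : pM.OK)
    (hqM : qM.OK) (NQ : ℝ) (hNQ0 : 0 ≤ NQ)
    (hc : 0 < c35) (H : MemberY d ℓ hd hL b₀ b₁ Mstar → Prop)
    -- the block equivalence of the instance («same carrier block»), its multiplicity and saturation
    (Rel : ∀ x : MemberY d ℓ hd hL b₀ b₁ Mstar, (geo9Y x).Site → (geo9Y x).Site → Prop) [∀ x, DecidableRel (Rel x)] (m mN : ℕ)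
    (Cev : ℝ) (hCev : 0 ≤ Cev)
    (hRlen : ∀ x (a a' : (geo9Y x).Site), Rel x a a' → (geo9Y x).len a = (geo9Y x).len a')
    (hRd₁ : ∀ x (a a' b : (geo9Y x).Site), Rel x a a' → (geo9Y x).dist a b = (geo9Y x).dist a' b)
    (hRd₂ : ∀ x (a b b' : (geo9Y x).Site), Rel x b b' → (geo9Y x).dist a b = (geo9Y x).dist a b')
    (hmult : ∀ x (y' : (geo9Y x).Site), (Finset.univ.filter (fun y'' => Rel x y'' y')).card ≤ m)
    (hnbr : ∀ (x : MemberY d ℓ hd hL b₀ b₁ Mstar) (y : (geo9Y x).Site), (nbr (geo9Y x) 2 y).card ≤ mN)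
    -- the G′ side (Theorem 3.7 ∕ Corollary 3.8)
    (𝔬 : ∀ x : MemberY d ℓ hd hL b₀ b₁ Mstar, Ops (geo9Y x) (bg x) (X x) (Y x) (ι x))
    (rd : ∀ x : MemberY d ℓ hd hL b₀ b₁ Mstar, WalkReading (geo9Y x) (bg x) (X x) (ι x))
    (𝔭 : ∀ x : MemberY d ℓ hd hL b₀ b₁ Mstar, HolderProbes (geo9Y x) (bg x) (X x) (Y x) (PX x) (PY x))
    (𝔡 : ∀ x : MemberY d ℓ hd hL b₀ b₁ Mstar, DirOps37 (𝔬 x) (Q x)) (𝔩 : ∀ x : MemberY d ℓ hd hL b₀ b₁ Mstar, DirLetters37 (𝔬 x) (Q x))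
    (bHX : ∀ x : MemberY d ℓ hd hL b₀ b₁ Mstar, ℝ → BlockNorm (toB6 (geo9Y x) 1 (H x)) (X x → ℝ))
    (K : ∀ x : MemberY d ℓ hd hL b₀ b₁ Mstar, B9.KernelFamily (geo9Y x) (bg x))
    (ev : ∀ x : MemberY d ℓ hd hL b₀ b₁ Mstar, (geo9Y x).Loc → X x → ℝ)
    (evY : ∀ x : MemberY d ℓ hd hL b₀ b₁ Mstar, (geo9Y x).Loc → Y x → ℝ)
    (κ : MemberY d ℓ hd hL b₀ b₁ Mstar → Sizes) (SH S3 SI SM : ∀ x : MemberY d ℓ hd hL b₀ b₁ Mstar, ι x → Finset (geo9Y x).Site)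
    (hst : ∀ x, StaticOK (𝔬 x) p.ρ p.Nc p.N' p.Cℓ (κ x)) (hκ : ∀ x, (κ x).Bounded p.Kc p.θ₀ p.Cℓ (geo9Y x).M)
    (hrd : ∀ x, (rd x).OKRel (𝔬 x).blk (Rel x)) (hloc : ∀ x, LocalityDir (𝔬 x) (𝔡 x) (𝔩 x) (rd x))
    (h36 : ∀ x, p.M₁ ≤ (geo9Y x).M → ∀ α₀ : ℝ, 0 < α₀ → c35 * (geo9Y x).M * α₀ ≤ p.a₁ →
      ∀ U : (bg x).Cfg, (bg x).Reg335 c35 α₀ U →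
        Local342 (𝔬 x) 1 (H x) p.B₀ p.δ₀ U ∧ DirSupSq37 (𝔬 x) (𝔡 x) 1 (H x) U ∧ Identities₂ (𝔬 x) (𝔡 x) (𝔩 x) 1 (H x) U)
    (h36H : ∀ x, p.M₁ ≤ (geo9Y x).M → ∀ α₀ : ℝ, 0 < α₀ → c35 * (geo9Y x).M * α₀ ≤ p.a₁ →
      ∀ U : (bg x).Cfg, (bg x).Reg335 c35 α₀ U →
        HolderLegs37 (𝔬 x) (𝔭 x) 1 (H x) (SH x) p.Bl p.δ₀ U ∧ HolderV37Dir (𝔬 x) (𝔡 x) (𝔩 x) (𝔭 x) 1 (H x) p.Bt p.δ₀ U ∧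
          (L2SecondLegs37 (𝔬 x) (𝔡 x) 1 (H x) (S3 x) p3.B3 p.δ₀ U ∧ (∀ q', IsTransposePair ((𝔬 x).Gsq U q') ((𝔬 x).Gsq U q')) ∧
            (∀ q' μ, IsTransposePair ((𝔩 x).Pt U q' μ) ((𝔩 x).P U q' μ)) ∧ (∀ q', IsTransposePair ((𝔬 x).Ct U q') ((𝔬 x).Cop U q')) ∧
            DirTranspose37 (𝔬 x) (𝔡 x) U) ∧
            (InputLegsPair37 (𝔬 x) (𝔡 x) (𝔭 x) 1 (H x) (bHX x) (SI x) p.BI p.BI2 p.δ₀ U ∧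
              FactorsInputPair37Dir (𝔬 x) (𝔡 x) (𝔩 x) 1 (H x) (bHX x) p.θI p.δ₀ U ∧ DirSupHolder37 (𝔬 x) (𝔡 x) (𝔭 x) 1 (H x) U) ∧
              (L2MixedLegs37 (𝔬 x) (𝔡 x) 1 (H x) (SM x) pM.BM p.δ₀ U ∧ FactorsL2Mixed37Dir (𝔬 x) (𝔡 x) (𝔩 x) 1 (H x) pM.θM p.δ₀ U ∧
                DirSup37 (𝔬 x) (𝔡 x) 1 (H x) U))
    (hco0 : ∀ x U, CoRealizesRel (K x) 0 U (Rel x) (𝔬 x).blk (𝔬 x).blk (ev x) ((𝔬 x).Gp U))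
    (hco1 : ∀ x U, CoRealizesRel (K x) 1 U (Rel x) (𝔬 x).blkY (𝔬 x).blk (ev x) ((𝔬 x).D U ∘ₗ (𝔬 x).Gp U))
    (hco2 : ∀ x U, CoRealizesRel (K x) 2 U (Rel x) (𝔬 x).blk (𝔬 x).blkY (evY x) ((𝔬 x).Gp U ∘ₗ (𝔬 x).Dstar U))
    (hco3 : ∀ x U, CoRealizesRel (K x) 3 U (Rel x) (𝔬 x).blk (𝔬 x).blk (ev x) ((𝔬 x).Lap U ∘ₗ (𝔬 x).Gp U))
    (hgl0 : ∀ x U, GlobReads (K x) 0 U (𝔬 x).blk (𝔬 x).blk (ev x) ((𝔬 x).Gp U))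
    (hgl1 : ∀ x U, GlobReads (K x) 1 U (𝔬 x).blkY (𝔬 x).blk (ev x) ((𝔬 x).D U ∘ₗ (𝔬 x).Gp U))
    (hgl2 : ∀ x U, GlobReads (K x) 2 U (𝔬 x).blk (𝔬 x).blkY (evY x) ((𝔬 x).Gp U ∘ₗ (𝔬 x).Dstar U))
    (hgl3 : ∀ x U, GlobReads (K x) 3 U (𝔬 x).blk (𝔬 x).blk (ev x) ((𝔬 x).Lap U ∘ₗ (𝔬 x).Gp U))
    (hl0 : ∀ x U, L2ReadsNbr (R := 1) (H := H x) (K x) 0 U (Rel x) 2 Cev (𝔬 x).blk (𝔬 x).blk (ev x) ((𝔬 x).Gp U))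
    (hl1 : ∀ x U, L2ReadsNbr (R := 1) (H := H x) (K x) 1 U (Rel x) 2 Cev (𝔬 x).blkY (𝔬 x).blk (ev x) ((𝔬 x).D U ∘ₗ (𝔬 x).Gp U))
    (hl2 : ∀ x U, L2ReadsNbr (R := 1) (H := H x) (K x) 2 U (Rel x) 2 Cev (𝔬 x).blk (𝔬 x).blkY (evY x) ((𝔬 x).Gp U ∘ₗ (𝔬 x).Dstar U))
    (hl3 : ∀ x U, L2ReadsNbr (R := 1) (H := H x) (K x) 3 U (Rel x) 2 Cev ((𝔬 x).blk ∘ Prod.fst) (𝔬 x).blk (ev x)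
      (familyOp fun p : Q x × Q x => (𝔡 x).Dd U p.1 ∘ₗ ((𝔬 x).Gp U ∘ₗ (𝔡 x).Dsd U p.2)))
    (hl4 : ∀ x U, L2ReadsNbr (R := 1) (H := H x) (K x) 4 U (Rel x) 2 Cev ((𝔬 x).blk ∘ Prod.fst) (𝔬 x).blk (ev x)
      (familyOp fun p : Q x × Q x => ((𝔡 x).Dd U p.1 ∘ₗ (𝔡 x).Dd U p.2) ∘ₗ (𝔬 x).Gp U))
    (hl5 : ∀ x U, L2ReadsNbr (R := 1) (H := H x) (K x) 5 U (Rel x) 2 Cev ((𝔬 x).blk ∘ Prod.fst) (𝔬 x).blk (ev x)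
      (familyOp fun p : Q x × Q x => (𝔬 x).Gp U ∘ₗ ((𝔡 x).Dsd U p.1 ∘ₗ (𝔡 x).Dsd U p.2)))
    (hH1 : ∀ x U, H1ReadsNbr (K x) U (𝔭 x) (Rel x) 2 (𝔬 x).blk (𝔬 x).blkY (ev x) (evY x) ((𝔬 x).D U ∘ₗ (𝔬 x).Gp U)
      ((𝔬 x).Gp U ∘ₗ (𝔬 x).Dstar U))
    (hIR : ∀ x U, InputReadsFam (K x) U (bHX x) 2 ((𝔬 x).blk ∘ Prod.fst) ((𝔭 x).blkPX ∘ Prod.fst)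
      (fun β => sliceProbe ((𝔭 x).ΦX U β)) (ev x)
      (familyOp fun p : Q x × Q x => (𝔡 x).Dd U p.1 ∘ₗ ((𝔬 x).Gp U ∘ₗ (𝔡 x).Dsd U p.2)))
    (hsym : ∀ x, p.M₁ ≤ (geo9Y x).M → ∀ α₀ : ℝ, 0 < α₀ → c35 * (geo9Y x).M * α₀ ≤ p.a₁ →
      ∀ U : (bg x).Cfg, (bg x).Reg335 c35 α₀ U → IsTransposePair ((𝔬 x).Gp U) ((𝔬 x).Gp U))
    (htr : ∀ x, p.M₁ ≤ (geo9Y x).M → ∀ α₀ : ℝ, 0 < α₀ → c35 * (geo9Y x).M * α₀ ≤ p.a₁ →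
      ∀ U : (bg x).Cfg, (bg x).Reg335 c35 α₀ U → IsTransposePair ((𝔬 x).D U ∘ₗ (𝔬 x).Gp U) ((𝔬 x).Gp U ∘ₗ (𝔬 x).Dstar U))
    (hcntH : ∀ x (a : (geo9Y x).Site), (∑ c, if a ∈ SH x c then (1 : ℝ) else 0) ≤ p.NH)
    (hcnt3 : ∀ x (a : (geo9Y x).Site), (∑ c, if a ∈ S3 x c then (1 : ℝ) else 0) ≤ p3.N3)
    (hNQ : ∀ x, (Fintype.card (Q x) : ℝ) ≤ NQ)
    (hcntI : ∀ x (a : (geo9Y x).Site), (∑ c, if a ∈ SI x c then (1 : ℝ) else 0) ≤ p.NI)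
    (hcntM : ∀ x (a : (geo9Y x).Site), (∑ c, if a ∈ SM x c then (1 : ℝ) else 0) ≤ pM.NM)
    -- the G side (Theorem 3.10)
    (𝔬A : ∀ x : MemberY d ℓ hd hL b₀ b₁ Mstar, Ops310 (geo9Y x) (bg x) (XA x) (YA x) (ιA x) (AA x))
    (rdA : ∀ x : MemberY d ℓ hd hL b₀ b₁ Mstar, WalkReading310 (geo9Y x) (bg x) (XA x) (ιA x) (AA x))
    (𝔭A : ∀ x : MemberY d ℓ hd hL b₀ b₁ Mstar, HolderProbes (geo9Y x) (bg x) (XA x) (YA x) (PXA x) (PYA x))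
    (𝔡A : ∀ x : MemberY d ℓ hd hL b₀ b₁ Mstar, DirOps310 (𝔬A x) (QA x))
    (𝔩A : ∀ x : MemberY d ℓ hd hL b₀ b₁ Mstar, DirLetters310 (𝔬A x) (QA x))
    (bHXA : ∀ x : MemberY d ℓ hd hL b₀ b₁ Mstar, ℝ → BlockNorm (toB6 (geo9Y x) 1 (H x)) (XA x → ℝ))
    (KA : ∀ x : MemberY d ℓ hd hL b₀ b₁ Mstar, B9.KernelFamily (geo9Y x) (bg x))
    (evA : ∀ x : MemberY d ℓ hd hL b₀ b₁ Mstar, (geo9Y x).Loc → XA x → ℝ)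
    (evYA : ∀ x : MemberY d ℓ hd hL b₀ b₁ Mstar, (geo9Y x).Loc → YA x → ℝ)
    (κA : MemberY d ℓ hd hL b₀ b₁ Mstar → Sizes310)
    (SHA S3A SIA SMA : ∀ x : MemberY d ℓ hd hL b₀ b₁ Mstar, ιA x → Finset (geo9Y x).Site)
    (hstA : ∀ x, StaticOK310 (𝔬A x) q.ρ q.Nc q.N' q.NF q.Cℓ (κA x)) (hκA : ∀ x, (κA x).Bounded q.Kc)
    (hrdA : ∀ x, (rdA x).OKRel (𝔬A x).blk (Rel x)) (hlocA : ∀ x, Locality310 (𝔬A x) (rdA x))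
    (h36A : ∀ x, q.M₁ ≤ (geo9Y x).M → ∀ α₀ : ℝ, 0 < α₀ → c35 * (geo9Y x).M * α₀ ≤ q.a₁ →
      ∀ U : (bg x).Cfg, (bg x).Reg335 c35 α₀ U →
        Local342G (𝔬A x) 1 (H x) q.B₀ q.δ₀ U ∧ B9Thm310Whole.Factors389 (𝔬A x) 1 (H x) q.θ₀ q.δ₀ U ∧
          DirSupSq310 (𝔬A x) (𝔡A x) 1 (H x) U ∧ Identities310₂ (𝔬A x) (𝔡A x) (𝔩A x) 1 (H x) U)
    (h36HA : ∀ x, q.M₁ ≤ (geo9Y x).M → ∀ α₀ : ℝ, 0 < α₀ → c35 * (geo9Y x).M * α₀ ≤ q.a₁ →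
      ∀ U : (bg x).Cfg, (bg x).Reg335 c35 α₀ U →
        HolderLegs310 (𝔬A x) (𝔭A x) 1 (H x) (SHA x) q.Bl q.δ₀ U ∧ FactorsHolder310 (𝔬A x) (𝔭A x) 1 (H x) q.Bt q.δ₀ U ∧
          (L2SecondLegs310 (𝔬A x) (𝔡A x) 1 (H x) (S3A x) q3.B3 q.δ₀ U ∧ (∀ a, IsTransposePair ((𝔬A x).Rt U a) ((𝔬A x).Rf U a)) ∧
            DirTranspose310 (𝔬A x) (𝔡A x) U) ∧
            (InputLegsPair310 (𝔬A x) (𝔡A x) (𝔭A x) 1 (H x) (bHXA x) (SIA x) q.BI q.BI2 q.δ₀ U ∧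
              FactorsInputPair310 (𝔬A x) (𝔡A x) 1 (H x) (bHXA x) q.θI q.δ₀ U ∧ DirSupHolder310 (𝔬A x) (𝔡A x) (𝔭A x) 1 (H x) U) ∧
              (L2MixedLegs310 (𝔬A x) (𝔡A x) 1 (H x) (SMA x) qM.BM q.δ₀ U ∧ FactorsL2Mixed310 (𝔬A x) (𝔡A x) 1 (H x) qM.θM q.δ₀ U ∧
                DirSup310 (𝔬A x) (𝔡A x) 1 (H x) U))
    (hcoA0 : ∀ x U, CoRealizesRel (KA x) 0 U (Rel x) (𝔬A x).blk (𝔬A x).blk (evA x) ((𝔬A x).G U))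
    (hcoA1 : ∀ x U, CoRealizesRel (KA x) 1 U (Rel x) (𝔬A x).blkY (𝔬A x).blk (evA x) ((𝔬A x).D U ∘ₗ (𝔬A x).G U))
    (hcoA2 : ∀ x U, CoRealizesRel (KA x) 2 U (Rel x) (𝔬A x).blk (𝔬A x).blkY (evYA x) ((𝔬A x).G U ∘ₗ (𝔬A x).Dstar U))
    (hcoA3 : ∀ x U, CoRealizesRel (KA x) 3 U (Rel x) (𝔬A x).blk (𝔬A x).blk (evA x) ((𝔬A x).Lap U ∘ₗ (𝔬A x).G U))
    (hglA0 : ∀ x U, GlobReads (KA x) 0 U (𝔬A x).blk (𝔬A x).blk (evA x) ((𝔬A x).G U))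
    (hglA1 : ∀ x U, GlobReads (KA x) 1 U (𝔬A x).blkY (𝔬A x).blk (evA x) ((𝔬A x).D U ∘ₗ (𝔬A x).G U))
    (hglA2 : ∀ x U, GlobReads (KA x) 2 U (𝔬A x).blk (𝔬A x).blkY (evYA x) ((𝔬A x).G U ∘ₗ (𝔬A x).Dstar U))
    (hglA3 : ∀ x U, GlobReads (KA x) 3 U (𝔬A x).blk (𝔬A x).blk (evA x) ((𝔬A x).Lap U ∘ₗ (𝔬A x).G U))
    (hlA0 : ∀ x U, L2ReadsNbr (R := 1) (H := H x) (KA x) 0 U (Rel x) 2 Cev (𝔬A x).blk (𝔬A x).blk (evA x) ((𝔬A x).G U))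
    (hlA1 : ∀ x U, L2ReadsNbr (R := 1) (H := H x) (KA x) 1 U (Rel x) 2 Cev (𝔬A x).blkY (𝔬A x).blk (evA x) ((𝔬A x).D U ∘ₗ (𝔬A x).G U))
    (hlA2 : ∀ x U, L2ReadsNbr (R := 1) (H := H x) (KA x) 2 U (Rel x) 2 Cev (𝔬A x).blk (𝔬A x).blkY (evYA x) ((𝔬A x).G U ∘ₗ (𝔬A x).Dstar U))
    (hlA3 : ∀ x U, L2ReadsNbr (R := 1) (H := H x) (KA x) 3 U (Rel x) 2 Cev ((𝔬A x).blk ∘ Prod.fst) (𝔬A x).blk (evA x)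
      (familyOp fun p : QA x × QA x => (𝔡A x).Dd U p.1 ∘ₗ ((𝔬A x).G U ∘ₗ (𝔡A x).Dsd U p.2)))
    (hlA4 : ∀ x U, L2ReadsNbr (R := 1) (H := H x) (KA x) 4 U (Rel x) 2 Cev ((𝔬A x).blk ∘ Prod.fst) (𝔬A x).blk (evA x)
      (familyOp fun p : QA x × QA x => ((𝔡A x).Dd U p.1 ∘ₗ (𝔡A x).Dd U p.2) ∘ₗ (𝔬A x).G U))
    (hlA5 : ∀ x U, L2ReadsNbr (R := 1) (H := H x) (KA x) 5 U (Rel x) 2 Cev ((𝔬A x).blk ∘ Prod.fst) (𝔬A x).blk (evA x)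
      (familyOp fun p : QA x × QA x => (𝔬A x).G U ∘ₗ ((𝔡A x).Dsd U p.1 ∘ₗ (𝔡A x).Dsd U p.2)))
    (hH1A : ∀ x U, H1ReadsNbr (KA x) U (𝔭A x) (Rel x) 2 (𝔬A x).blk (𝔬A x).blkY (evA x) (evYA x) ((𝔬A x).D U ∘ₗ (𝔬A x).G U)
      ((𝔬A x).G U ∘ₗ (𝔬A x).Dstar U))
    (hIRA : ∀ x U, InputReadsFam (KA x) U (bHXA x) 2 ((𝔬A x).blk ∘ Prod.fst) ((𝔭A x).blkPX ∘ Prod.fst)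
      (fun β => sliceProbe ((𝔭A x).ΦX U β)) (evA x)
      (familyOp fun p : QA x × QA x => (𝔡A x).Dd U p.1 ∘ₗ ((𝔬A x).G U ∘ₗ (𝔡A x).Dsd U p.2)))
    (hsymA : ∀ x, q.M₁ ≤ (geo9Y x).M → ∀ α₀ : ℝ, 0 < α₀ → c35 * (geo9Y x).M * α₀ ≤ q.a₁ →
      ∀ U : (bg x).Cfg, (bg x).Reg335 c35 α₀ U → IsTransposePair ((𝔬A x).G U) ((𝔬A x).G U))
    (htrA : ∀ x, q.M₁ ≤ (geo9Y x).M → ∀ α₀ : ℝ, 0 < α₀ → c35 * (geo9Y x).M * α₀ ≤ q.a₁ →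
      ∀ U : (bg x).Cfg, (bg x).Reg335 c35 α₀ U → IsTransposePair ((𝔬A x).D U ∘ₗ (𝔬A x).G U) ((𝔬A x).G U ∘ₗ (𝔬A x).Dstar U))
    (hcntHA : ∀ x (a : (geo9Y x).Site), (∑ c, if a ∈ SHA x c then (1 : ℝ) else 0) ≤ q.NH)
    (hcnt3A : ∀ x (a : (geo9Y x).Site), (∑ c, if a ∈ S3A x c then (1 : ℝ) else 0) ≤ q3.N3)
    (hNQA : ∀ x, (Fintype.card (QA x) : ℝ) ≤ NQ)
    (hcntIA : ∀ x (a : (geo9Y x).Site), (∑ c, if a ∈ SIA x c then (1 : ℝ) else 0) ≤ q.NI)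
    (hcntMA : ∀ x (a : (geo9Y x).Site), (∑ c, if a ∈ SMA x c then (1 : ℝ) else 0) ≤ qM.NM) :
    B9.Thm37Printed c35 geo9Y bg (fun x => E37YPairMDir (bg := bg) m mN Cev NQ p q (⟨p3.N3, 2 * p3.B3, 0⟩ : PairPrims)
          (⟨q3.N3, 2 * q3.B3, 0⟩ : PairPrims) pM qM (𝔬 x) (𝔡 x) (𝔩 x) (rd x) (H x) (K x)) ∧
      B9.Cor38Printed c35 geo9Y bg (fun x => E37YPairMDir (bg := bg) m mN Cev NQ p q (⟨p3.N3, 2 * p3.B3, 0⟩ : PairPrims)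
          (⟨q3.N3, 2 * q3.B3, 0⟩ : PairPrims) pM qM (𝔬 x) (𝔡 x) (𝔩 x) (rd x) (H x) (K x)) ∧
      B9.Thm310Printed c35 geo9Y bg (fun x => E310YPairM (bg := bg) m mN Cev NQ p q (⟨p3.N3, 2 * p3.B3, 0⟩ : PairPrims)
          (⟨q3.N3, 2 * q3.B3, 0⟩ : PairPrims) pM qM (𝔬A x) (rdA x) (H x) (KA x)) ∧
      B9.RWSumsYieldIneqs geo9Y bg (fun x => E37YPairMDir (bg := bg) m mN Cev NQ p q (⟨p3.N3, 2 * p3.B3, 0⟩ : PairPrims)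
          (⟨q3.N3, 2 * q3.B3, 0⟩ : PairPrims) pM qM (𝔬 x) (𝔡 x) (𝔩 x) (rd x) (H x) (K x))
        (fun x => E310YPairM (bg := bg) m mN Cev NQ p q (⟨p3.N3, 2 * p3.B3, 0⟩ : PairPrims)
          (⟨q3.N3, 2 * q3.B3, 0⟩ : PairPrims) pM qM (𝔬A x) (rdA x) (H x) (KA x)) K KA := by
  set dp : ℕ := exp261 (@geo9Y d ℓ hd hL b₀ b₁ Mstar) p.δ₀ p.α with hdp
  set dFp : ℕ := exp261 (@geo9Y d ℓ hd hL b₀ b₁ Mstar) ((1 - 2 * p.α) * p.δ₀) (1 - p.αF) with hdFp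
  set dq : ℕ := exp261 (@geo9Y d ℓ hd hL b₀ b₁ Mstar) q.δ₀ q.α with hdq
  set dFq : ℕ := exp261 (@geo9Y d ℓ hd hL b₀ b₁ Mstar) ((1 - 2 * q.α) * q.δ₀) (1 - q.αF) with hdFq
  set L₀ : ℝ := ((ℓ + 1 : ℕ) : ℝ) with hL₀
  have hL₀0 : 0 ≤ L₀ := by rw [hL₀]; positivity
  have hB1Y : 0 ≤ B1Y p q dp dFp dq dFq L₀ := (B1Y_pos p q dp dFp dq dFq L₀).le
  obtain ⟨hN3p, hB3p, -⟩ := hp3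
  obtain ⟨hN3q, hB3q, -⟩ := hq3
  set P3 : PairPrims := ⟨p3.N3, 2 * p3.B3, 0⟩ with hP3
  set Q3 : PairPrims := ⟨q3.N3, 2 * q3.B3, 0⟩ with hQ3
  have hN3P : 0 ≤ P3.N3 := by rw [hP3]; exact hN3p
  have hB3P : 0 ≤ P3.B3 := by rw [hP3]; exact mul_nonneg zero_le_two hB3p
  have hθ3P : 0 ≤ P3.θ3 := by rw [hP3]
  have hN3Q : 0 ≤ Q3.N3 := by rw [hQ3]; exact hN3q
  have hB3Q : 0 ≤ Q3.B3 := by rw [hQ3]; exact mul_nonneg zero_le_two hB3q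
  have hθ3Q : 0 ≤ Q3.θ3 := by rw [hQ3]
  have hCp0 : 0 ≤ p.C dp := PinPrims.C_nonneg hp dp
  have hCq0 : 0 ≤ q.C dq := PinPrims.C_nonneg hq dq
  have hscp : 0 ≤ secondConst dp p.δ₀ p.α P3.N3 P3.B3 p.N' P3.θ3 (p.C dp) L₀ := secondConst_nonneg hN3P hB3P hp.N'_nn hθ3P hCp0 hL₀0
  have hscq : 0 ≤ secondConst dq q.δ₀ q.α Q3.N3 Q3.B3 q.NF Q3.θ3 (q.C dq) L₀ := secondConst_nonneg hN3Q hB3Q hq.NF_nn hθ3Q hCq0 hL₀0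
  obtain ⟨hNMp, hBMp, hθMp⟩ := hpM
  obtain ⟨hNMq, hBMq, hθMq⟩ := hqM
  have hmcp : 0 ≤ mixedConst dp p.δ₀ p.α pM.NM pM.BM p.N' pM.θM (p.C dp) L₀ := mixedConst_nonneg hNMp hBMp hp.N'_nn hθMp hCp0 hL₀0
  have hmcq : 0 ≤ mixedConst dq q.δ₀ q.α qM.NM qM.BM q.NF qM.θM (q.C dq) L₀ := mixedConst_nonneg hNMq hBMq hq.NF_nn hθMq hCq0 hL₀0
  have hB1le₀ : B1Y p q dp dFp dq dFq L₀ ≤ B1Pair p q P3 Q3 NQ dp dFp dq dFq L₀ :=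
    le_add_of_nonneg_right (mul_nonneg hNQ0 (add_nonneg hscp hscq))
  have hPM : B1Pair p q P3 Q3 NQ dp dFp dq dFq L₀ ≤ B1PairM p q P3 Q3 pM qM NQ dp dFp dq dFq L₀ :=
    le_add_of_nonneg_right (mul_nonneg hNQ0 (add_nonneg hmcp hmcq))
  have hB1le : B1Y p q dp dFp dq dFq L₀ ≤ B1PairM p q P3 Q3 pM qM NQ dp dFp dq dFq L₀ := hB1le₀.trans hPM
  have hB1P0 : 0 ≤ B1Pair p q P3 Q3 NQ dp dFp dq dFq L₀ := hB1Y.trans hB1le₀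
  have hBp := (lowerB_le_B1Y_left₄ p q dp dFp dq dFq L₀).trans hB1le
  have hBq := (lowerB_le_B1Y_right₄ p q dp dFp dq dFq L₀).trans hB1le
  have hB1 : 0 ≤ B1PairM p q P3 Q3 pM qM NQ dp dFp dq dFq L₀ := hB1Y.trans hB1le
  have hB1pos : 0 < B1PairM p q P3 Q3 pM qM NQ dp dFp dq dFq L₀ := lt_of_lt_of_le (B1Y_pos p q dp dFp dq dFq L₀) hB1le
  have h35p : NQ * secondConst dp p.δ₀ p.α P3.N3 P3.B3 p.N' P3.θ3 (p.C dp) L₀ ≤ B1PairM p q P3 Q3 pM qM NQ dp dFp dq dFq L₀ :=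
    calc NQ * secondConst dp p.δ₀ p.α P3.N3 P3.B3 p.N' P3.θ3 (p.C dp) L₀
        ≤ NQ * secondConst dp p.δ₀ p.α P3.N3 P3.B3 p.N' P3.θ3 (p.C dp) L₀ +
          (B1Y p q dp dFp dq dFq L₀ + NQ * secondConst dq q.δ₀ q.α Q3.N3 Q3.B3 q.NF Q3.θ3 (q.C dq) L₀) :=
          le_add_of_nonneg_right (add_nonneg hB1Y (mul_nonneg hNQ0 hscq))
      _ = B1Pair p q P3 Q3 NQ dp dFp dq dFq L₀ := by unfold B1Pair; ring
      _ ≤ B1PairM p q P3 Q3 pM qM NQ dp dFp dq dFq L₀ := hPM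
  have h35q : NQ * secondConst dq q.δ₀ q.α Q3.N3 Q3.B3 q.NF Q3.θ3 (q.C dq) L₀ ≤ B1PairM p q P3 Q3 pM qM NQ dp dFp dq dFq L₀ :=
    calc NQ * secondConst dq q.δ₀ q.α Q3.N3 Q3.B3 q.NF Q3.θ3 (q.C dq) L₀
        ≤ NQ * secondConst dq q.δ₀ q.α Q3.N3 Q3.B3 q.NF Q3.θ3 (q.C dq) L₀ +
          (B1Y p q dp dFp dq dFq L₀ + NQ * secondConst dp p.δ₀ p.α P3.N3 P3.B3 p.N' P3.θ3 (p.C dp) L₀) :=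
          le_add_of_nonneg_right (add_nonneg hB1Y (mul_nonneg hNQ0 hscp))
      _ = B1Pair p q P3 Q3 NQ dp dFp dq dFq L₀ := by unfold B1Pair; ring
      _ ≤ B1PairM p q P3 Q3 pM qM NQ dp dFp dq dFq L₀ := hPM
  have hMp : NQ * mixedConst dp p.δ₀ p.α pM.NM pM.BM p.N' pM.θM (p.C dp) L₀ ≤ B1PairM p q P3 Q3 pM qM NQ dp dFp dq dFq L₀ :=
    calc NQ * mixedConst dp p.δ₀ p.α pM.NM pM.BM p.N' pM.θM (p.C dp) L₀
        ≤ NQ * mixedConst dp p.δ₀ p.α pM.NM pM.BM p.N' pM.θM (p.C dp) L₀ +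
          (B1Pair p q P3 Q3 NQ dp dFp dq dFq L₀ + NQ * mixedConst dq q.δ₀ q.α qM.NM qM.BM q.NF qM.θM (q.C dq) L₀) :=
          le_add_of_nonneg_right (add_nonneg hB1P0 (mul_nonneg hNQ0 hmcq))
      _ = B1PairM p q P3 Q3 pM qM NQ dp dFp dq dFq L₀ := by unfold B1PairM; ring
  have hMq : NQ * mixedConst dq q.δ₀ q.α qM.NM qM.BM q.NF qM.θM (q.C dq) L₀ ≤ B1PairM p q P3 Q3 pM qM NQ dp dFp dq dFq L₀ :=
    calc NQ * mixedConst dq q.δ₀ q.α qM.NM qM.BM q.NF qM.θM (q.C dq) L₀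
        ≤ NQ * mixedConst dq q.δ₀ q.α qM.NM qM.BM q.NF qM.θM (q.C dq) L₀ +
          (B1Pair p q P3 Q3 NQ dp dFp dq dFq L₀ + NQ * mixedConst dp p.δ₀ p.α pM.NM pM.BM p.N' pM.θM (p.C dp) L₀) :=
          le_add_of_nonneg_right (add_nonneg hB1P0 (mul_nonneg hNQ0 hmcp))
      _ = B1PairM p q P3 Q3 pM qM NQ dp dFp dq dFq L₀ := by unfold B1PairM; ring
  -- the scale and its order facts
  have hsc3p : secondConst dp p.δ₀ p.α P3.N3 P3.B3 p.N' P3.θ3 (p.C dp) L₀ = 2 * (p3.N3 * p3.B3) := by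
    simp only [hP3, secondConst]; ring
  have hsc3q : secondConst dq q.δ₀ q.α Q3.N3 Q3.B3 q.NF Q3.θ3 (q.C dq) L₀ = 2 * (q3.N3 * q3.B3) := by
    simp only [hQ3, secondConst]; ring
  have h35p' : NQ * (2 * (p3.N3 * p3.B3)) ≤ B1PairM p q P3 Q3 pM qM NQ dp dFp dq dFq L₀ := hsc3p ▸ h35p
  have h35q' : NQ * (2 * (q3.N3 * q3.B3)) ≤ B1PairM p q P3 Q3 pM qM NQ dp dFp dq dFq L₀ := hsc3q ▸ h35q
  have h2p : 0 ≤ NQ * (2 * (p3.N3 * p3.B3)) := mul_nonneg hNQ0 (mul_nonneg zero_le_two (mul_nonneg hN3p hB3p))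
  have h2q : 0 ≤ NQ * (2 * (q3.N3 * q3.B3)) := mul_nonneg hNQ0 (mul_nonneg zero_le_two (mul_nonneg hN3q hB3q))
  have hδ1 : 0 < delta1Y p q := delta1Y_pos hp hq
  have he0 : 0 ≤ Real.exp (2 * delta1Y p q) := Real.exp_nonneg _
  have hL1 : (1 : ℝ) ≤ L₀ := by rw [hL₀]; exact_mod_cast Nat.succ_le_succ (Nat.zero_le ℓ)
  have hm0 : (0 : ℝ) ≤ m := Nat.cast_nonneg m
  obtain ⟨hs1, hsm, hsL2, hsmL, hse, hsLe⟩ := nbrScale_facts m mN hCev hL1 hδ1.le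
  set s : ℝ := nbrScale m mN Cev L₀ (delta1Y p q) with hsname
  have hs0 : (0 : ℝ) ≤ s := zero_le_one.trans hs1
  -- the scaled relations: k·X ≤ s·B for 0 ≤ k ≤ s, 0 ≤ X ≤ B; X ≤ s·B for X ≤ B, 0 ≤ B
  have scK : ∀ {k X B : ℝ}, 0 ≤ k → k ≤ s → 0 ≤ X → X ≤ B → k * X ≤ s * B := fun hk hks hX hXB =>
    mul_le_mul hks hXB hX hs0
  have sc0 : ∀ {X B : ℝ}, X ≤ B → 0 ≤ B → X ≤ s * B := fun hXB hB => hXB.trans (le_mul_of_one_le_left hB hs1)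
  have hmLe0 : 0 ≤ (m : ℝ) * L₀ * Real.exp (2 * delta1Y p q) := by positivity
  have hAe0 : 0 ≤ (mN : ℝ) * m * Cev * L₀ ^ 2 * Real.exp (2 * delta1Y p q) := by positivity
  have hLe0 : 0 ≤ L₀ * Real.exp (2 * delta1Y p q) := by positivity
  have hCp : 0 ≤ p.C dp := PinPrims.C_nonneg hp dp
  have hCq : 0 ≤ q.C dq := PinPrims.C_nonneg hq dq
  have hc1p : 0 ≤ B6.c1 dp p.δ₀ p.α := c1_nonneg _ _ _
  have hc1q : 0 ≤ B6.c1 dq q.δ₀ q.α := c1_nonneg _ _ _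
  have hhold_p : ∀ β, 0 ≤ β → β < 1 → 0 ≤ holderConst dp p.δ₀ p.α p.NH p.N' (p.C dp) (p.Bl β) (p.Bt β) := by
    intro β h0 h1
    have := hp.NH_nn; have := hp.N'_nn; have := hp.Bl_nn β h0 h1; have := hp.Bt_nn β h0 h1
    unfold holderConst; positivity
  have hhold_q : ∀ β, 0 ≤ β → β < 1 → 0 ≤ holderConst dq q.δ₀ q.α q.NH q.NF (q.C dq) (q.Bl β) (q.Bt β) := by
    intro β h0 h1
    have := hq.NH_nn; have := hq.NF_nn; have := hq.Bl_nn β h0 h1; have := hq.Bt_nn β h0 h1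
    unfold holderConst; positivity
  have hin44_p : ∀ ε, 0 < ε → ε ≤ 1 → 0 ≤ inputConst44 dp p.δ₀ p.α p.NI p.N' (p.C dp) L₀ (p.BI ε) (p.θI ε) := by
    intro ε h0 h1
    have := hp.NI_nn; have := hp.N'_nn; have := hp.BI_nn ε h0 h1; have := hp.θI_nn ε h0
    unfold inputConst44; positivity
  have hin44_q : ∀ ε, 0 < ε → ε ≤ 1 → 0 ≤ inputConst44 dq q.δ₀ q.α q.NI q.NF (q.C dq) L₀ (q.BI ε) (q.θI ε) := by
    intro ε h0 h1
    have := hq.NI_nn; have := hq.NF_nn; have := hq.BI_nn ε h0 h1; have := hq.θI_nn ε h0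
    unfold inputConst44; positivity
  have hin45_p : ∀ ε β, 0 < ε → ε ≤ 1 → 0 ≤ β → β < 1 →
      0 ≤ inputConst45 dp p.δ₀ p.α p.NI p.N' L₀ (holderConst dp p.δ₀ p.α p.NH p.N' (p.C dp) (p.Bl β) (p.Bt β)) (p.BI2 ε β)
        (p.θI (β + ε)) := by
    intro ε β h0 h1 hβ0 hβ1
    have := hp.NI_nn; have := hp.N'_nn; have := hp.BI2_nn ε β h0 h1 hβ0 hβ1; have := hp.θI_nn (β + ε) (by linarith)
    have := hhold_p β hβ0 hβ1
    unfold inputConst45; positivity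
  have hin45_q : ∀ ε β, 0 < ε → ε ≤ 1 → 0 ≤ β → β < 1 →
      0 ≤ inputConst45 dq q.δ₀ q.α q.NI q.NF L₀ (holderConst dq q.δ₀ q.α q.NH q.NF (q.C dq) (q.Bl β) (q.Bt β)) (q.BI2 ε β)
        (q.θI (β + ε)) := by
    intro ε β h0 h1 hβ0 hβ1
    have := hq.NI_nn; have := hq.NF_nn; have := hq.BI2_nn ε β h0 h1 hβ0 hβ1; have := hq.θI_nn (β + ε) (by linarith)
    have := hhold_q β hβ0 hβ1
    unfold inputConst45; positivity
  obtain ⟨t37, c38⟩ := thm37_cor38_complete_geo9Y_pairM_dir₄ (bg := bg) (B₁ := s * B1PairM p q P3 Q3 pM qM NQ dp dFp dq dFq L₀)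
    (δ₁ := delta1Y p q) (Bβ := fun β => s * BbetaY p q dp dq β) (Bε := fun ε => s * BepsY p q dp dq L₀ ε)
    (Bεβ := fun ε β => s * BepsbetaY p q dp dq L₀ ε β) 𝔬 rd H 𝔭 𝔡 𝔩 bHX K ev evY Rel m Cev mN hRlen hRd₁ hRd₂ hmult hnbr hCev κ SH S3 SI SM
    p.Bl p.Bt p.BI p.θI p.BI2 p.α p.ρ p.Nc p.N' p.Cℓ p.Kc p.θ₀ p.B₀ p.δ₀ p.a₁ p.M₁ p.αF p.NH p3.N3 p3.B3 NQ p.NI pM.NM pM.BM pM.θM hc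
    hp.α_pos hp.α_lt hp.Nc_nn hp.N'_nn hp.one_le_Cℓ hp.Kc_nn hp.θ₀_nn hp.B₀_pos hp.δ₀_pos hp.a₁_pos hp.M₁_pos hp.αF_pos
    hp.αF_lt.le hp.NH_nn hN3p hB3p hp.NI_nn hNMp hBMp hθMp hst hκ hrd hloc h36 h36H hco0 hco1 hco2 hco3 hgl0
    hgl1 hgl2 hgl3 hl0 hl1 hl2 hl3 hl4 hl5 hH1 hIR hsym htr hcntH hcnt3 hNQ hcntI hcntM hp.Bl_nn hp.Bt_nn hp.BI_nn hp.BI2_nn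
    hp.θI_nn (scK hm0 hsm hCp ((le_pinLowerB₁₄ _ _ _ _ _).trans hBp))
    (scK hAe0 hsL2 (mul_nonneg hCp hL₀0) ((le_pinLowerB₂₄ _ _ _ _ _).trans hBp)) hδ1.le (min_le_left _ _)
    (sc0 ((le_pinLowerB₃₄ _ _ _ _ _).trans hBp) hB1)
    (scK hAe0 hsL2 h2p h35p')
    (scK hAe0 hsL2 (mul_nonneg hNQ0 hmcp) hMp)
    (fun β h0 h1 => scK hmLe0 hsmL (hhold_p β h0 h1) (le_max_left _ _))
    (fun ε h0 h1 => scK he0 hse (hin44_p ε h0 h1) (le_max_left _ _))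
    (fun ε β h0 h1 hβ0 hβ1 => scK hLe0 hsLe (hin45_p ε β h0 h1 hβ0 hβ1) (le_max_left _ _))
  have t310 := thm310_complete_geo9Y_pairM_dir₄ (bg := bg) (B₁ := s * B1PairM p q P3 Q3 pM qM NQ dp dFp dq dFq L₀) (δ₁ := delta1Y p q)
    (Bβ := fun β => s * BbetaY p q dp dq β) (Bε := fun ε => s * BepsY p q dp dq L₀ ε)
    (Bεβ := fun ε β => s * BepsbetaY p q dp dq L₀ ε β) 𝔬A rdA H 𝔭A 𝔡A 𝔩A bHXA KA evA evYA Rel m Cev mN hRlen hRd₁ hRd₂ hmult hnbr hCev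
    κA SHA S3A SIA SMA q.Bl q.Bt q.BI q.θI q.BI2 q.α q.ρ q.Nc q.N' q.NF q.Cℓ q.Kc q.θ₀ q.B₀ q.δ₀ q.a₁ q.M₁ q.αF q.NH q3.N3 q3.B3
    NQ q.NI qM.NM qM.BM qM.θM hc hq.α_pos hq.α_lt hq.Nc_nn hq.N'_nn hq.NF_nn hq.one_le_Cℓ hq.Kc_nn hq.θ₀_nn hq.B₀_pos hq.δ₀_pos
    hq.a₁_pos hq.M₁_pos hq.αF_pos hq.αF_lt.le hq.NH_nn hN3q hB3q hq.NI_nn hNMq hBMq hθMq hstA hκA hrdA hlocA h36A h36HA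
    hcoA0 hcoA1 hcoA2 hcoA3 hglA0 hglA1 hglA2 hglA3 hlA0 hlA1 hlA2 hlA3 hlA4 hlA5 hH1A hIRA hsymA htrA hcntHA hcnt3A hNQA hcntIA
    hcntMA hq.Bl_nn hq.Bt_nn hq.BI_nn hq.BI2_nn hq.θI_nn
    (scK hm0 hsm hCq ((le_pinLowerB₁₄ _ _ _ _ _).trans hBq))
    (scK hAe0 hsL2 (mul_nonneg hCq hL₀0) ((le_pinLowerB₂₄ _ _ _ _ _).trans hBq)) hδ1.le (min_le_right _ _)
    (sc0 ((le_pinLowerB₃₄ _ _ _ _ _).trans hBq) hB1)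
    (scK hAe0 hsL2 h2q h35q')
    (scK hAe0 hsL2 (mul_nonneg hNQ0 hmcq) hMq)
    (fun β h0 h1 => scK hmLe0 hsmL (hhold_q β h0 h1) (le_max_right _ _))
    (fun ε h0 h1 => scK he0 hse (hin44_q ε h0 h1) (le_max_right _ _))
    (fun ε β h0 h1 hβ0 hβ1 => scK hLe0 hsLe (hin45_q ε β h0 h1 hβ0 hβ1) (le_max_right _ _))
  exact ⟨t37, c38, t310, rwSumsYieldIneqs_allPins _ 𝔬 (fun _ => 1) H _ _ 𝔬A rdA (fun _ => 1) H _ _ K KA _ _ _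
    (mul_pos (lt_of_lt_of_le one_pos hs1) hB1pos) (delta1Y_pos hp hq)⟩

end StageY

end

end Literature.MathematicalPhysics.QuantumFieldTheory.Balaban1983to89.B9RWSumsDefinitePinsPairMDir4Rows
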